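import Summits.Ventures.Crystal3D.StickySpheres.SmallContactStratum
import Summits.Ventures.Crystal3D.StickySpheres.SmallContactBase
import HarnessLib

/-!
# Small contact numbers: `C(5) = 9` outright, witnesses `C(7) ≥ 15, C(8) ≥ 18, C(9) ≥ 21`, and
# `C(n) = 3n − 6 (n ≤ 9)` from the three non-realisability sweeps alone

Venture `Crystal3D` (cell `pub-crystal3d`, seat p2), assembling `SmallContactBase.lean` (`C(4) = 6`, docking on the
tetrahedron), `SmallContactStratum.lean` (the exposed-triangle-free induction), `RadiusOne.lean` (p3: integer models,
`C(6) = 12`) and the tree's `no_five_pairwise_dist_two`.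

HONEST FRAMING. PROVED here outright: `9 ≤ C(5)` (dock on the tetrahedron), `C(5) = 9` (ten contacts among five balls
would be five mutually touching balls — impossible in `ℝ³`), `15 ≤ C(7)`, `18 ≤ C(8)`, `21 ≤ C(9)` (capped fcc octahedra as
integer models), hence the WITNESS side of `C(n) = 3n − 6` for every `4 ≤ n ≤ 9`. CONDITIONAL: `C(7) = 15, C(8) = 18,
C(9) = 21` follow from the three census statements `S(15,7), S(18,8), S(21,9)` (`StratumHypothesis`: no packing of
`n` balls with all coordinations `≥ 3` has more than `3n − 6` contacts, i.e. every graph on `n` vertices with minimum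
degree `≥ 3` and `≥ 3n − 5` edges is not a contact graph) — exactly what the cell's exact sweep certifies; NOT proved here.
Nothing about crystallization.
-/

noncomputable section

open Finset
open scoped BigOperators

namespace Summit.Ventures.Crystal3D

open Literature.Geometry.DiscreteGeometry (sqNormInt)
open Literature.Barriers.AtomisticToContinuum (intContactNumber intConfig contactNumber no_five_pairwise_dist_two)

/-! ### 1. `C(5) = 9` -/

/-- Every maximal four-ball packing has an exposed triangle (`HasExposedTriangle` form of
`exists_docking_of_maximal_four`). [folklore] -/
theorem hasExposedTriangle_of_maximal_four {x : Fin 4 → EuclideanSpace ℝ (Fin 3)}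
    (hxe : numContacts x = maxContacts 3 4) : HasExposedTriangle x :=
  exists_docking_of_maximal_four hxe

/-- **`9 ≤ C(5)`**: dock a fifth ball on a face of a maximal (tetrahedral) four-ball packing. [folklore] -/
theorem nine_le_maxContacts_five : 9 ≤ maxContacts 3 5 := by
  obtain ⟨x, hx, hxe⟩ := exists_numContacts_eq_maxContacts (by norm_num : 0 < 3) 4
  have h := maxContacts_add_three_le hx hxe (hasExposedTriangle_of_maximal_four hxe)
  rw [maxContacts_three_four] at h
  exact h

/-- The ten label pairs `i < j` of `Fin 5`. [folklore] -/
theorem card_pairs_five : ((univ : Finset (Fin 5 × Fin 5)).filter fun p => p.1 < p.2).card = 10 := by decide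

/-- **No five-ball packing has ten contacts** (five mutually touching balls do not exist in `ℝ³`,
`no_five_pairwise_dist_two`), so every five-ball configuration has at most nine pairs at distance `1`. [folklore] -/
theorem numContacts_le_nine_of_five (x : Fin 5 → EuclideanSpace ℝ (Fin 3)) :
    numContacts x ≤ 9 := by
  classical
  have hsub : contactPairs x ⊆ (univ : Finset (Fin 5 × Fin 5)).filter fun p => p.1 < p.2 :=
    fun p hp => mem_filter.2 ⟨mem_univ _, ((mem_contactPairs x).1 hp).1⟩
  have h10 : numContacts x ≤ 10 := by rw [numContacts, ← card_pairs_five]; exact card_le_card hsub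
  by_contra h9
  have heq : contactPairs x = (univ : Finset (Fin 5 × Fin 5)).filter fun p => p.1 < p.2 :=
    eq_of_subset_of_card_le hsub (by rw [card_pairs_five]; unfold numContacts at h9 h10; omega)
  have hall : ∀ i j : Fin 5, i ≠ j → dist (x i) (x j) = 1 := by
    intro i j hij
    rcases lt_or_gt_of_ne hij with hlt | hlt
    · have : (i, j) ∈ contactPairs x := by rw [heq]; exact mem_filter.2 ⟨mem_univ _, hlt⟩
      exact ((mem_contactPairs x).1 this).2
    · have : (j, i) ∈ contactPairs x := by rw [heq]; exact mem_filter.2 ⟨mem_univ _, hlt⟩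
      rw [dist_comm]; exact ((mem_contactPairs x).1 this).2
  exact no_five_pairwise_dist_two (fun i => (2 : ℝ) • x i) fun i j hij => by
    rw [dist_two_smul, hall i j hij]; norm_num

/-- **`C(5) = 9`** (the triangular bipyramid): unconditional. [folklore] -/
theorem maxContacts_three_five : maxContacts 3 5 = 9 :=
  le_antisymm (maxContacts_le (by norm_num) fun x _ => numContacts_le_nine_of_five x) nine_le_maxContacts_five

/-! ### 2. Witnesses `C(7) ≥ 15`, `C(8) ≥ 18`, `C(9) ≥ 21`: capped fcc octahedra (contact at squared distance `2`) -/

/-- fcc octahedron `(0,0,0),(2,0,0),(1,±1,0),(1,0,±1)` with caps `(0,1,1)`, `(2,−1,−1)`, `(0,−1,−1)` (the first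
`7`, `8`, `9` rows give `15`, `18`, `21` contacts). [folklore] -/
def cappedOctaInt : Fin 9 → Fin 3 → ℤ :=
  ![![0, 0, 0], ![2, 0, 0], ![1, 1, 0], ![1, -1, 0], ![1, 0, 1], ![1, 0, -1], ![0, 1, 1], ![2, -1, -1], ![0, -1, -1]]

/-- First `7` balls. [folklore] -/
def cappedOcta7 : Fin 7 → Fin 3 → ℤ := fun i => cappedOctaInt (Fin.castLE (by norm_num) i)
/-- First `8` balls. [folklore] -/
def cappedOcta8 : Fin 8 → Fin 3 → ℤ := fun i => cappedOctaInt (Fin.castLE (by norm_num) i)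

/-- Contact counts of the integer models. [folklore] -/
theorem intContactNumber_cappedOcta :
    intContactNumber cappedOcta7 2 = 15 ∧ intContactNumber cappedOcta8 2 = 18 ∧ intContactNumber cappedOctaInt 2 = 21 := by
  refine ⟨?_, ?_, ?_⟩ <;> decide +kernel

/-- Separation of the integer models. [folklore] -/
theorem sep_cappedOcta :
    (∀ i j : Fin 7, i ≠ j → (2 : ℤ) ≤ sqNormInt (cappedOcta7 i - cappedOcta7 j)) ∧
    (∀ i j : Fin 8, i ≠ j → (2 : ℤ) ≤ sqNormInt (cappedOcta8 i - cappedOcta8 j)) ∧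
    (∀ i j : Fin 9, i ≠ j → (2 : ℤ) ≤ sqNormInt (cappedOctaInt i - cappedOctaInt j)) := by
  refine ⟨?_, ?_, ?_⟩ <;> decide +kernel

/-- **`15 ≤ C(7)`, `18 ≤ C(8)`, `21 ≤ C(9)`.** [folklore] -/
theorem le_maxContacts_seven_eight_nine :
    15 ≤ maxContacts 3 7 ∧ 18 ≤ maxContacts 3 8 ∧ 21 ≤ maxContacts 3 9 :=
  ⟨le_maxContacts_of_intConfig cappedOcta7 (by norm_num) sep_cappedOcta.1 intContactNumber_cappedOcta.1,
   le_maxContacts_of_intConfig cappedOcta8 (by norm_num) sep_cappedOcta.2.1 intContactNumber_cappedOcta.2.1,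
   le_maxContacts_of_intConfig cappedOctaInt (by norm_num) sep_cappedOcta.2.2 intContactNumber_cappedOcta.2.2⟩

/-- **The witness side for every `4 ≤ n ≤ 9`: `3n − 6 ≤ C(n)`** (unconditional). [folklore] -/
theorem three_mul_sub_six_le_maxContacts {n : ℕ} (h4 : 4 ≤ n) (h9 : n ≤ 9) : 3 * n - 6 ≤ maxContacts 3 n := by
  obtain ⟨h7, h8, h9'⟩ := le_maxContacts_seven_eight_nine
  interval_cases n
  · rw [maxContacts_three_four]
  · rw [maxContacts_three_five]
  · rw [maxContacts_three_six]
  · exact h7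
  · exact h8
  · exact h9'

/-! ### 3. `C(n) = 3n − 6` for `n ≤ 9` from the three sweeps -/

/-- `S(9, 5)` holds outright (no five-ball packing exceeds nine contacts). [folklore] -/
theorem stratumHypothesis_five : StratumHypothesis 9 5 := fun x _ _ => numContacts_le_nine_of_five x

/-- `S(12, 6)` holds outright (`C(6) = 12`, tree). [folklore] -/
theorem stratumHypothesis_six : StratumHypothesis 12 6 := fun _ hx _ => by
  have := numContacts_le_maxContacts hx; rwa [maxContacts_three_six] at this

/-- **`C(n) = 3n − 6` for `4 ≤ n ≤ 9`, conditional exactly on the census sweeps `S(15,7)`, `S(18,8)`, `S(21,9)`**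
(every graph on `n = 7, 8, 9` vertices with minimum degree `≥ 3` and at least `16, 19, 22` edges is not the contact graph
of a unit packing). The cases `n ≤ 6` are unconditional. [folklore] -/
theorem maxContacts_eq_three_mul_sub_six_le_nine (hS7 : StratumHypothesis 15 7) (hS8 : StratumHypothesis 18 8)
    (hS9 : StratumHypothesis 21 9) {n : ℕ} (h4 : 4 ≤ n) (h9 : n ≤ 9) : maxContacts 3 n = 3 * n - 6 := by
  refine maxContacts_eq_three_mul_sub_six (n₂ := 9) maxContacts_three_four
    (fun m hm hm9 => three_mul_sub_six_le_maxContacts hm.le hm9) (fun m hm hm9 => ?_) n h4 h9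
  interval_cases m
  · exact stratumHypothesis_five
  · exact stratumHypothesis_six
  · exact hS7
  · exact hS8
  · exact hS9

/-- **`C(7) = 15` from the single sweep `S(15,7)`.** [folklore] -/
theorem maxContacts_three_seven (hS7 : StratumHypothesis 15 7) : maxContacts 3 7 = 15 := by
  refine le_antisymm ?_ le_maxContacts_seven_eight_nine.1
  obtain ⟨x, hx, hxe⟩ := exists_numContacts_eq_maxContacts (by norm_num : 0 < 3) 7
  have hgrow : maxContacts 3 6 + 3 ≤ maxContacts 3 7 := by
    rw [maxContacts_three_six]; exact le_maxContacts_seven_eight_nine.1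
  rw [← hxe]
  exact hS7 x hx (three_le_coordination_of_maximal hx hxe hgrow)

end Summit.Ventures.Crystal3D

end
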